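import Mathlib

/-!
# The fixed field of `Aut(L/K)` for an algebraically closed `L` (T4-B2, step B2.4(b))

Sub-claim B2 of route/TIER4.md computes the reflex field of the unitary Shimura datum as the
fixed field in `ℂ` of a stabiliser subgroup of `Aut(ℂ)` (Liu, App. C, Def. C.1) and uses, in
step B2.4(b), the elementary fact

  `Fix(Aut(ℂ/k)) = k` for every subfield `k ⊂ ℂ`

(proved there by a transcendence-basis argument in the transcendental case and by a
conjugate-root argument in the algebraic case).  This file kernel-checks that fact in the
general form

  `K` a field of characteristic `0`, `L ⊇ K` algebraically closed  ⇒
  `x ∈ L` is fixed by every `K`-automorphism of `L` iff `x ∈ K`,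

following exactly the two cases of B2.4(b):
* `x` algebraic over `K`: the relative algebraic closure `A` of `K` in `L` is a Galois extension
  of `K` (Mathlib: `IsAlgClosure.isGalois`), so some element of `Gal(A/K)` moves `x`
  (`InfiniteGalois.mem_bot_iff_fixed`); it is extended to `L` through a transcendence basis of
  `L/A` and `IsAlgClosure.equivOfEquiv`;
* `x` transcendental over `K`: `x` is part of a transcendence basis `t` of `L` over `A`, the
  substitution `X_x ↦ X_x + 1` is an automorphism of `A(t)` moving `x`, and it is extended to
  `L` in the same way.

Everything here is Mathlib + elementary; no statement about varieties is made.
-/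

namespace Summit.Ventures.HodgeRepro2.FixedFieldAut

open IntermediateField

section Lift

variable {K L M : Type*} [Field K] [Field L] [Field M]
  [Algebra K L] [Algebra K M] [Algebra M L] [IsScalarTower K M L]
  [IsAlgClosed L] [Algebra.IsAlgebraic M L]

/-- **Extension step.** If `L` is algebraically closed and algebraic over an intermediate field
`M ⊇ K`, every `K`-automorphism of `M` extends to a `K`-automorphism of `L`
(`IsAlgClosure.equivOfEquiv` applied to `L` as an algebraic closure of `M` in two ways). -/
theorem exists_algEquiv_extend (e : M ≃ₐ[K] M) :
    ∃ σ : L ≃ₐ[K] L, ∀ m : M, σ (algebraMap M L m) = algebraMap M L (e m) := by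
  haveI : IsAlgClosure M L := ⟨inferInstance, inferInstance⟩
  let T : L ≃+* L := IsAlgClosure.equivOfEquiv L L (e : M ≃+* M)
  have hT : ∀ m : M, T (algebraMap M L m) = algebraMap M L (e m) := fun m =>
    IsAlgClosure.equivOfEquiv_algebraMap L L (e : M ≃+* M) m
  refine ⟨AlgEquiv.ofRingEquiv (f := T) fun k => ?_, hT⟩
  rw [IsScalarTower.algebraMap_apply K M L k, hT, e.commutes]

end Lift

section Main

variable {K L : Type*} [Field K] [Field L] [Algebra K L] [CharZero K] [IsAlgClosed L]

omit [IsAlgClosed L] in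
/-- Constants of `A[t]`, viewed in `A(t) ⊂ L` through `AlgebraicIndependent.aevalEquivField`,
are the images of `A` in `L` (bookkeeping for both cases below). -/
theorem coe_aevalEquivField_algebraMap_C {A : Type*} [Field A] [Algebra A L] {ι : Type*}
    {v : ι → L} (hv : AlgebraicIndependent A v) (a : A) :
    ((hv.aevalEquivField (algebraMap (MvPolynomial ι A) (FractionRing (MvPolynomial ι A))
      (MvPolynomial.C a)) : adjoin A (Set.range v)) : L) = algebraMap A L a := by
  rw [AlgebraicIndependent.aevalEquivField_algebraMap_apply_coe, MvPolynomial.aeval_C]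

/-- **Algebraic case of B2.4(b).** If `x ∈ L` is algebraic over `K` but not in `K`, some
`K`-automorphism of `L` moves it. -/
theorem exists_algEquiv_ne_of_isAlgebraic (x : L) (hx : x ∉ Set.range (algebraMap K L))
    (halg : IsAlgebraic K x) : ∃ σ : L ≃ₐ[K] L, σ x ≠ x := by
  -- the relative algebraic closure `A` of `K` in `L`, a Galois extension of `K`
  set A : IntermediateField K L := algebraicClosure K L with hA
  have hxA : x ∈ A := mem_algebraicClosure_iff.2 halg
  let x' : A := ⟨x, hxA⟩
  haveI : IsGalois K A := IsAlgClosure.isGalois K A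
  have hx' : x' ∉ (⊥ : IntermediateField K A) := by
    intro h
    rcases IntermediateField.mem_bot.1 h with ⟨k, hk⟩
    apply hx
    refine ⟨k, ?_⟩
    have h2 := congrArg (algebraMap A L) hk
    rwa [← IsScalarTower.algebraMap_apply K A L] at h2
  have hnot : ¬ ∀ f : Gal(A/K), f x' = x' := fun h =>
    hx' ((InfiniteGalois.mem_bot_iff_fixed x').2 h)
  obtain ⟨f, hf⟩ := not_forall.1 hnot
  -- a transcendence basis `s` of `L` over `A`; `L` is algebraic over `M := A(s)`
  obtain ⟨s, hs⟩ := exists_isTranscendenceBasis A L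
  set M : IntermediateField A L := adjoin A (Set.range ((↑) : s → L)) with hM
  haveI : Algebra.IsAlgebraic M L := hs.isAlgebraic_field
  haveI : IsScalarTower K M L := IsScalarTower.of_algebraMap_eq fun k => rfl
  -- the automorphism of `M` induced by `f` on the coefficients
  let φ₀ : MvPolynomial s A ≃ₐ[K] MvPolynomial s A := MvPolynomial.mapAlgEquiv s f
  let φ₁ : FractionRing (MvPolynomial s A) ≃ₐ[K] FractionRing (MvPolynomial s A) :=
    IsFractionRing.algEquivOfAlgEquiv φ₀
  let ψ : FractionRing (MvPolynomial s A) ≃ₐ[K] M := (hs.1.aevalEquivField).restrictScalars K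
  let e : M ≃ₐ[K] M := ψ.symm.trans (φ₁.trans ψ)
  have hψ : ∀ a : A, ψ (algebraMap (MvPolynomial s A) (FractionRing (MvPolynomial s A))
      (MvPolynomial.C a)) = algebraMap A M a := by
    intro a
    apply Subtype.ext
    exact coe_aevalEquivField_algebraMap_C hs.1 a
  have he : ∀ a : A, e (algebraMap A M a) = algebraMap A M (f a) := by
    intro a
    have h1 : ψ.symm (algebraMap A M a) = algebraMap (MvPolynomial s A)
        (FractionRing (MvPolynomial s A)) (MvPolynomial.C a) := by
      rw [AlgEquiv.symm_apply_eq, hψ]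
    show ψ (φ₁ (ψ.symm (algebraMap A M a))) = _
    rw [h1, IsFractionRing.algEquivOfAlgEquiv_algebraMap]
    show ψ (algebraMap (MvPolynomial s A) (FractionRing (MvPolynomial s A))
      (MvPolynomial.map (f : A →+* A) (MvPolynomial.C a))) = _
    rw [MvPolynomial.map_C, hψ]
    rfl
  obtain ⟨σ, hσ⟩ := exists_algEquiv_extend (K := K) (L := L) e
  refine ⟨σ, ?_⟩
  have hxM : x = algebraMap M L (algebraMap A M x') := by
    rw [← IsScalarTower.algebraMap_apply A M L]
    rfl
  rw [hxM, hσ, he]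
  intro h
  apply hf
  have h3 := (algebraMap M L).injective h
  exact (algebraMap A M).injective h3

omit [CharZero K] in
/-- **Transcendental case of B2.4(b)** (no characteristic assumption is needed here). If `x ∈ L` is transcendental over `K`, some
`K`-automorphism of `L` sends `x` to `x + 1`. -/
theorem exists_algEquiv_ne_of_transcendental (x : L) (htr : ¬ IsAlgebraic K x) :
    ∃ σ : L ≃ₐ[K] L, σ x ≠ x := by
  classical
  set A : IntermediateField K L := algebraicClosure K L with hA
  -- `x` is transcendental over `A` as well
  have htrA : Transcendental A x := by
    intro h
    have h1 : x ∈ algebraicClosure A L := mem_algebraicClosure_iff.2 h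
    rw [algebraicClosure.algebraicClosure_eq_bot] at h1
    rcases IntermediateField.mem_bot.1 h1 with ⟨a, ha⟩
    apply htr
    rw [← ha]
    exact mem_algebraicClosure_iff.1 a.2
  -- a transcendence basis `t ∋ x` of `L` over `A`
  have hsing : AlgebraicIndepOn A id ({x} : Set L) :=
    (algebraicIndependent_singleton_iff (R := A) (⟨x, rfl⟩ : ({x} : Set L))).2 htrA
  obtain ⟨t, hxt, ht⟩ := exists_isTranscendenceBasis_superset hsing
  let x₀ : t := ⟨x, hxt (Set.mem_singleton x)⟩
  set M : IntermediateField A L := adjoin A (Set.range ((↑) : t → L)) with hM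
  haveI : Algebra.IsAlgebraic M L := ht.isAlgebraic_field
  haveI : IsScalarTower K M L := IsScalarTower.of_algebraMap_eq fun k => rfl
  -- the substitution `X_x ↦ X_x + 1` on `A[t]`, lifted to `A(t) = M`
  let φ₀ : MvPolynomial t A ≃ₐ[A] MvPolynomial t A :=
    AlgEquiv.ofAlgHom
      (MvPolynomial.aeval fun i => MvPolynomial.X i + if i = x₀ then 1 else 0)
      (MvPolynomial.aeval fun i => MvPolynomial.X i - if i = x₀ then 1 else 0)
      (MvPolynomial.algHom_ext fun i => by simp)
      (MvPolynomial.algHom_ext fun i => by simp)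
  let φ₁ : FractionRing (MvPolynomial t A) ≃ₐ[A] FractionRing (MvPolynomial t A) :=
    IsFractionRing.algEquivOfAlgEquiv φ₀
  let ψ : FractionRing (MvPolynomial t A) ≃ₐ[A] M := ht.1.aevalEquivField
  let e : M ≃ₐ[A] M := ψ.symm.trans (φ₁.trans ψ)
  let m₀ : M := ⟨x, subset_adjoin A _ ⟨x₀, rfl⟩⟩
  have hψ0 : ψ (algebraMap (MvPolynomial t A) (FractionRing (MvPolynomial t A))
      (MvPolynomial.X x₀)) = m₀ := by
    apply Subtype.ext
    rw [AlgebraicIndependent.aevalEquivField_algebraMap_apply_coe, MvPolynomial.aeval_X]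
  have hψ1 : ((ψ (algebraMap (MvPolynomial t A) (FractionRing (MvPolynomial t A))
      (MvPolynomial.X x₀ + 1)) : M) : L) = x + 1 := by
    rw [AlgebraicIndependent.aevalEquivField_algebraMap_apply_coe, map_add, MvPolynomial.aeval_X,
      map_one]
  have he : ((e m₀ : M) : L) = x + 1 := by
    have h1 : ψ.symm m₀ = algebraMap (MvPolynomial t A) (FractionRing (MvPolynomial t A))
        (MvPolynomial.X x₀) := by
      rw [AlgEquiv.symm_apply_eq, hψ0]
    show ((ψ (φ₁ (ψ.symm m₀)) : M) : L) = x + 1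
    rw [h1, IsFractionRing.algEquivOfAlgEquiv_algebraMap]
    have h2 : φ₀ (MvPolynomial.X x₀) = MvPolynomial.X x₀ + 1 := by
      show (MvPolynomial.aeval fun i => MvPolynomial.X i + if i = x₀ then 1 else 0)
        (MvPolynomial.X x₀) = _
      simp
    rw [h2, hψ1]
  obtain ⟨σ, hσ⟩ := exists_algEquiv_extend (K := K) (L := L) (e.restrictScalars K)
  refine ⟨σ, ?_⟩
  have hxM : x = algebraMap M L m₀ := rfl
  rw [hxM, hσ]
  show ((e m₀ : M) : L) ≠ x
  rw [he]
  exact fun h => one_ne_zero (add_left_cancel (a := x) (h.trans (add_zero x).symm))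

/-- **B2.4(b), general form.** `K` of characteristic `0`, `L ⊇ K` algebraically closed:
an element of `L` outside `K` is moved by some `K`-automorphism of `L`. -/
theorem exists_algEquiv_ne (x : L) (hx : x ∉ Set.range (algebraMap K L)) :
    ∃ σ : L ≃ₐ[K] L, σ x ≠ x := by
  by_cases h : IsAlgebraic K x
  · exact exists_algEquiv_ne_of_isAlgebraic x hx h
  · exact exists_algEquiv_ne_of_transcendental x h

/-- **B2.4(b).** `Fix(Aut(L/K)) = K`: an element of `L` is fixed by every `K`-automorphism of
`L` if and only if it lies in (the image of) `K`. -/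
theorem mem_range_algebraMap_iff_forall_algEquiv (x : L) :
    x ∈ Set.range (algebraMap K L) ↔ ∀ σ : L ≃ₐ[K] L, σ x = x := by
  constructor
  · rintro ⟨k, rfl⟩ σ
    exact σ.commutes k
  · intro h
    by_contra hx
    obtain ⟨σ, hσ⟩ := exists_algEquiv_ne x hx
    exact hσ (h σ)

/-- **B2.4(b) in the language of intermediate fields**: the fixed field of the full automorphism
group `Aut(L/K)` is the bottom intermediate field `K`. -/
theorem fixedField_top :
    IntermediateField.fixedField (⊤ : Subgroup (L ≃ₐ[K] L)) = (⊥ : IntermediateField K L) := by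
  ext x
  rw [IntermediateField.mem_fixedField_iff, IntermediateField.mem_bot,
    mem_range_algebraMap_iff_forall_algEquiv]
  exact ⟨fun h σ => h σ (Subgroup.mem_top σ), fun h σ _ => h σ⟩

end Main

section Complex

/-- **B2.4(b) as used in B2.4(c):** for a subfield `k ⊂ ℂ` (for B2: `k = F₁ = τ₁(F)`), the set of
complex numbers fixed by every `k`-automorphism of `ℂ` is exactly `k`. -/
theorem complex_fixed_eq (k : Subfield ℂ) :
    {x : ℂ | ∀ σ : ℂ ≃ₐ[k] ℂ, σ x = x} = (k : Set ℂ) := by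
  ext x
  simp only [Set.mem_setOf_eq, SetLike.mem_coe]
  rw [← mem_range_algebraMap_iff_forall_algEquiv (K := k)]
  constructor
  · rintro ⟨y, rfl⟩
    exact y.2
  · intro hx
    exact ⟨⟨x, hx⟩, rfl⟩

end Complex

end Summit.Ventures.HodgeRepro2.FixedFieldAut
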